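import Literature.NumberTheory.Automorphic.IdeleClassGroupCyclicLayerClassModule
import Literature.Algebra.Homology.NormGroups
import HarnessLib

/-!
# The fundamental class of a CYCLIC layer `(Gal(E/F), C_E)` normalised by the Artin map: a class
# module structure whose norm residue symbol IS the reciprocity map (Tate, Cassels–Fröhlich VII
# §11.3 "the norm residue map of the class formation coincides with the Artin map"; Neukirch,
# *Bonn Lectures* II §1 (1.9)–(1.11))

Topic `NumberTheory/Automorphic` (idèles, idèle classes); namespace
`Literature.NumberTheory.Automorphic.IdeleClassGroup`.  Proof file: theorems only (no definition, no
named fact, no instance, no notation, no `sorry`; D-0026).  Sequel to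
`IdeleClassGroupCyclicLayerClassModule` (door-c6 g8: `∃ φ, IsClassModule (galoisRep F E) φ` for
cyclic `E/F`, the generator obtained abstractly from the cyclicity of `C_E^G/N_G C_E`) and the
engine's `NormGroups` (`IsClassModule.normResidueSymbol`, `normResidueSymbol_nakayamaSum :
(Σ_τ φ(τ, g), ·) = ḡ⁻¹`) / `FiniteCyclicH2CarryCocycle` (the carry cocycle `c · a`,
`normResidueCarryEquiv`).

For a cyclic extension of number fields `E/F` and ANY homomorphism `ψ : 𝕀_F → Gal(E/F)` onto with
kernel the norm group `Fˣ N_{E/F} 𝕀_E` — the tree's Artin map (`exists_artinMap_of_isAbelianGalois`,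
`artinIdeleMapOfAlgebra`) is one — there is a 2-cocycle `φ` of `C_E` with `IsClassModule (galoisRep F E) φ`
whose NORM RESIDUE SYMBOL (the engine's abstract reciprocity map `C_E^G = ι(C_F) → Gal(E/F)^{ab}`
of Tate's theorem) is `ψ`: `(ι[x], E/F) = ψ(x)` for every idèle `x` of `F`
(`exists_isClassModule_normResidueSymbol_eq`).  Construction: `φ = c · ι[x₀]`, the carry cocycle of a
generator `σ` of `Gal(E/F)` on the invariant class `ι[x₀]` with `ψ(x₀) = σ⁻¹` (`Σ_τ φ(τ, σ) = ι[x₀]`,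
so `(ι[x₀], E/F) = σ = ψ(x₀)⁻¹⁻¹`); both `x ↦ (ι[x], E/F)` and `ψ` kill `Fˣ N 𝕀_E` and `𝕀_F/Fˣ N 𝕀_E`
is generated by `x₀`.  This pins the fundamental class of a cyclic layer (two fundamental classes with
the same norm residue symbol coincide) by the RECIPROCITY LAW the tree proved cohomology-free, in
place of Tate's invariant map.

* §1 `ofMul_classBaseChange_mem_invariants` (`ι[x] ∈ C_E^G`), `classBaseChange_mem_range_norm_of_mem_normGroup`
  (`ι[Fˣ N 𝕀_E] ⊆ N_G C_E`).
* §2 **`exists_isClassModule_normResidueSymbol_eq`** (any `ψ` onto with kernel the norm group),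
  **`exists_isClassModule_normResidueSymbol_frobenius`** (for the tree's Artin map: uniformisers at
  unramified primes go to Frobenii).

## References
* J. W. S. Cassels, A. Fröhlich (eds.), *Algebraic Number Theory* (1967), Ch. VII (J. Tate) §11.3
  (the reciprocity map of the class formation is the Artin map). [CasselsFrohlichANT1967]
* J. Neukirch, *Class Field Theory — The Bonn Lectures* (2013), II §1 Thm. (1.9) and the Nakayama
  map. [Neukirch2013]
-/

noncomputable section

open CategoryTheory CategoryTheory.Limits groupCohomology

namespace Literature.NumberTheory.Automorphic

namespace IdeleClassGroup

open Literature.NumberTheory.GaloisRepresentations Literature.Algebra.Homology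

variable {F E : Type} [Field F] [Field E] [Algebra F E] [NumberField F] [NumberField E]

/-! ## §1. The invariant classes `ι[x]` and the norm group -/

/-- `ι[x] ∈ C_E^{Gal(E/F)}` for every idèle `x` of `F` (classes from the base are fixed).
[cite: CasselsFrohlichANT1967, Ch. VII §8 Prop. 8.1] -/
theorem ofMul_classBaseChange_mem_invariants (x : ideleGroup F) :
    Additive.ofMul (classBaseChange F E (x : IdeleClassGroup F)) ∈ (galoisRep F E).ρ.invariants :=
  (mem_invariants_galoisRep _).2 fun g =>
    show classGalAct g (classBaseChange F E (x : IdeleClassGroup F)) = _ from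
      classGalAct_classBaseChange g _

/-- **`ι[Fˣ N_{E/F} 𝕀_E] ⊆ N_G C_E`**: the class of a norm-group idèle is a norm of the module `C_E`
(`ι[a · N y] = N̄[y]`). [cite: CasselsFrohlichANT1967, Ch. VII §9 Thm. 9.1 (proof, Step 2)] -/
theorem classBaseChange_mem_range_norm_of_mem_normGroup {x : ideleGroup F} (hx : x ∈ normGroup F E) :
    Additive.ofMul (classBaseChange F E (x : IdeleClassGroup F)) ∈ LinearMap.range (galoisRep F E).ρ.norm := by
  classical
  obtain ⟨a, ha, z, hz, rfl⟩ := Subgroup.mem_sup.1 hx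
  obtain ⟨w, hw⟩ := mem_idelicNormSubgroup_iff.1 hz
  have haz : ((a * z : ideleGroup F) : IdeleClassGroup F) = (z : IdeleClassGroup F) := by
    rw [QuotientGroup.mk_mul, (QuotientGroup.eq_one_iff a).2 ha]
    exact one_mul ((z : ideleGroup F) : IdeleClassGroup F)
  refine ⟨Additive.ofMul (w : IdeleClassGroup E), ?_⟩
  rw [norm_galoisRep_apply, haz, classBaseChange_mk, ← hw, ← classGalNorm_mk]
  rfl

/-- In a cyclic group generated by `s`, given a surjection `ψ` onto it: every `x` is `x₀ ^ k · n` with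
`ψ n = 1`, for any `x₀` with `ψ x₀ = s`. [folklore] -/
private theorem exists_zpow_mul_mem_ker {M G : Type} [CommGroup M] [Group G] (ψ : M →* G) {s : G}
    (hs : ∀ g, g ∈ Subgroup.zpowers s) {x₀ : M} (hx₀ : ψ x₀ = s) (x : M) :
    ∃ (k : ℤ) (n : M), n ∈ ψ.ker ∧ x = x₀ ^ k * n := by
  obtain ⟨k, hk⟩ := Subgroup.mem_zpowers_iff.1 (hs (ψ x))
  refine ⟨k, (x₀ ^ k)⁻¹ * x, ?_, by rw [mul_inv_cancel_left]⟩
  rw [MonoidHom.mem_ker, map_mul, map_inv, map_zpow, hx₀, hk, inv_mul_cancel]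

/-! ## §2. The class-module structure with prescribed norm residue symbol -/

/-- **A cyclic layer `(Gal(E/F), C_E)` has a fundamental class whose norm residue symbol is the Artin
map**: for `E/F` cyclic and any `ψ : 𝕀_F → Gal(E/F)` onto with kernel `Fˣ N_{E/F} 𝕀_E` (e.g. the
Artin map of the tree's reciprocity law), there is `φ` with `IsClassModule (galoisRep F E) φ` and
`(ι[x], E/F)_φ = ψ(x)` in `Gal(E/F)^{ab}` for every idèle `x` of `F` — `φ = c · ι[x₀]`, the carry
cocycle of a generator `σ` on `ι[x₀]`, `ψ(x₀) = σ⁻¹`.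
[cite: CasselsFrohlichANT1967, Ch. VII §11.3][cite: Neukirch2013, Part II §1 Thm. (1.9)] -/
theorem exists_isClassModule_normResidueSymbol_eq [IsGalois F E] [IsCyclic (E ≃ₐ[F] E)]
    (ψ : ideleGroup F →* (E ≃ₐ[F] E)) (hψ : Function.Surjective ψ) (hker : ψ.ker = normGroup F E) :
    ∃ (φ : cocycles₂ (galoisRep F E)) (hA : IsClassModule (galoisRep F E) φ),
      ∀ x : ideleGroup F,
        hA.normResidueSymbol ⟨_, ofMul_classBaseChange_mem_invariants (E := E) x⟩ =
          Abelianization.of (ψ x) := by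
  classical
  -- the additive homomorphism `ι̂ : 𝕀_F → C_E^G`, `x ↦ ι[x]`
  let ιhat : ideleGroup F →* Multiplicative ((galoisRep F E).ρ.invariants) :=
    { toFun := fun x => Multiplicative.ofAdd ⟨_, ofMul_classBaseChange_mem_invariants (E := E) x⟩
      map_one' := by
        rw [← ofAdd_zero]
        congr 1
        refine Subtype.ext ?_
        change Additive.ofMul (classBaseChange F E ((1 : ideleGroup F) : IdeleClassGroup F)) = 0
        rw [QuotientGroup.mk_one, map_one]
        rfl
      map_mul' := fun x y => by
        rw [← ofAdd_add]
        congr 1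
        refine Subtype.ext ?_
        change Additive.ofMul (classBaseChange F E ((x * y : ideleGroup F) : IdeleClassGroup F)) =
          Additive.ofMul (classBaseChange F E (x : IdeleClassGroup F)) +
            Additive.ofMul (classBaseChange F E (y : IdeleClassGroup F))
        rw [QuotientGroup.mk_mul, map_mul]
        rfl }
  have hιhat : ∀ x : ideleGroup F, Multiplicative.toAdd (ιhat x) =
      ⟨_, ofMul_classBaseChange_mem_invariants (E := E) x⟩ := fun _ => rfl
  by_cases hG : Nontrivial (E ≃ₐ[F] E)
  swap
  · -- trivial group: everything is forced
    haveI : Subsingleton (E ≃ₐ[F] E) := not_nontrivial_iff_subsingleton.1 hG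
    obtain ⟨φ, hA⟩ := exists_isClassModule_galoisRep F E
    have h1 : ∀ y : Abelianization (E ≃ₐ[F] E), y = 1 := fun y => by
      induction y using QuotientGroup.induction_on with
      | H g => rw [Subsingleton.elim g 1]; rfl
    exact ⟨φ, hA, fun x => by rw [h1 (hA.normResidueSymbol _), h1 (Abelianization.of _)]⟩
  haveI := hG
  obtain ⟨σ, hσ⟩ := IsCyclic.exists_generator (α := E ≃ₐ[F] E)
  have hσ' : ∀ g : E ≃ₐ[F] E, g ∈ Subgroup.zpowers σ⁻¹ := fun g => by
    rw [Subgroup.zpowers_inv]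
    exact hσ g
  obtain ⟨x₀, hx₀⟩ := hψ σ⁻¹
  -- the invariant class `a = ι[x₀]` and the carry cocycle `φ = c · a`
  set a : (galoisRep F E).ρ.invariants := ⟨_, ofMul_classBaseChange_mem_invariants (E := E) x₀⟩ with ha
  let φ : cocycles₂ (galoisRep F E) :=
    Unramified.frobeniusCocycle σ hσ (galoisRep F E) (a : (galoisRep F E).V) fun g => a.2 g
  have hφ : H2π (galoisRep F E) φ =
      FiniteCyclic.normResidueCarryEquiv σ hσ (galoisRep F E) (Submodule.Quotient.mk a) := rfl
  -- every `x` is `x₀ ^ k · n` with `n` in the norm group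
  have hdecomp : ∀ x : ideleGroup F, ∃ (k : ℤ) (n : ideleGroup F), n ∈ normGroup F E ∧ x = x₀ ^ k * n :=
    fun x => by
      obtain ⟨k, n, hn, h⟩ := exists_zpow_mul_mem_ker ψ hσ' hx₀ x
      exact ⟨k, n, hker ▸ hn, h⟩
  -- norm-group idèles give classes in `N_G C_E`, i.e. `0` in `C_E^G / N_G C_E`
  have hnorm : ∀ n ∈ normGroup F E,
      (Submodule.Quotient.mk (Multiplicative.toAdd (ιhat n)) :
        (galoisRep F E).ρ.invariants ⧸ LinearMap.range (normBar (galoisRep F E).ρ)) = 0 := by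
    intro n hn
    rw [Submodule.Quotient.mk_eq_zero, mem_range_normBar_iff, hιhat]
    exact classBaseChange_mem_range_norm_of_mem_normGroup hn
  -- `[a]` generates `C_E^G / N_G C_E`
  have hgen : AddSubgroup.zmultiples (Submodule.Quotient.mk a :
      (galoisRep F E).ρ.invariants ⧸ LinearMap.range (normBar (galoisRep F E).ρ)) = ⊤ := by
    rw [eq_top_iff]
    intro q _
    induction q using Submodule.Quotient.induction_on with
    | H s =>
      obtain ⟨c, hc⟩ : Additive.toMul s.1 ∈ (classBaseChange F E).range :=
        (mem_range_classBaseChange_iff (F := F) _).2 ((mem_invariants_galoisRep s.1).1 s.2)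
      obtain ⟨x, rfl⟩ := QuotientGroup.mk_surjective c
      obtain ⟨k, n, hn, rfl⟩ := hdecomp x
      have hs : s = Multiplicative.toAdd (ιhat (x₀ ^ k * n)) := by
        rw [hιhat]
        exact Subtype.ext (by change s.1 = Additive.ofMul (classBaseChange F E _); rw [hc]; rfl)
      rw [hs, map_mul, map_zpow, toAdd_mul, toAdd_zpow, Submodule.Quotient.mk_add,
        Submodule.Quotient.mk_smul, hnorm n hn, add_zero]
      exact AddSubgroup.zsmul_mem _ (AddSubgroup.mem_zmultiples _) k
  -- hence `[φ]` has order `|Gal(E/F)|`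
  have hcardH0 : Nat.card ((galoisRep F E).ρ.invariants ⧸ LinearMap.range (normBar (galoisRep F E).ρ)) =
      Nat.card (E ≃ₐ[F] E) := by
    rw [Nat.card_congr (FiniteCyclic.normResidueCarryEquiv σ hσ (galoisRep F E)).toEquiv,
      natCard_H2_galoisRep_eq_card]
  have horder : addOrderOf (H2π (galoisRep F E) φ) = Nat.card (E ≃ₐ[F] E) := by
    rw [hφ]
    change addOrderOf ((FiniteCyclic.normResidueCarryEquiv σ hσ (galoisRep F E)).toAddMonoidHom
      (Submodule.Quotient.mk a)) = _
    rw [addOrderOf_injective (FiniteCyclic.normResidueCarryEquiv σ hσ (galoisRep F E)).toAddMonoidHom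
      (FiniteCyclic.normResidueCarryEquiv σ hσ (galoisRep F E)).injective, ← hcardH0,
      ← Nat.card_zmultiples, hgen, AddSubgroup.card_top]
  have hA : IsClassModule (galoisRep F E) φ :=
    IsClassModule.of_card (fun U => isZero_H1_res_galoisRep U)
      (natCard_groupCohomology_two_res_galoisRep F E) horder
  refine ⟨φ, hA, fun x => ?_⟩
  -- `(a, E/F) = σ = ψ(x₀)`: `Σ_τ φ(τ, σ) = a`
  have hcard1 : 1 < Fintype.card (E ≃ₐ[F] E) := Fintype.one_lt_card
  have hsum : Nakayama.nakayamaSum φ σ = a :=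
    Subtype.ext (by
      rw [Nakayama.coe_nakayamaSum]
      exact Unramified.sum_frobeniusCocycle_self σ hσ (galoisRep F E) (a : (galoisRep F E).V)
        (fun g => a.2 g) hcard1)
  have ha_symbol : hA.normResidueSymbol a = Abelianization.of (ψ x₀) := by
    rw [← hsum, hA.normResidueSymbol_nakayamaSum, ← map_inv, hx₀]
  -- decompose `x = x₀ ^ k · n`
  obtain ⟨k, n, hn, rfl⟩ := hdecomp x
  have hsplit : (⟨_, ofMul_classBaseChange_mem_invariants (E := E) (x₀ ^ k * n)⟩ :
      (galoisRep F E).ρ.invariants) = k • a + Multiplicative.toAdd (ιhat n) := by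
    rw [← hιhat, map_mul, map_zpow, toAdd_mul, toAdd_zpow]
    rfl
  have hn1 : hA.normResidueSymbol (Multiplicative.toAdd (ιhat n)) = 1 := by
    rw [hA.normResidueSymbol_eq_one_iff, hιhat]
    exact classBaseChange_mem_range_norm_of_mem_normGroup hn
  have hψn : ψ n = 1 := by rw [← MonoidHom.mem_ker, hker]; exact hn
  -- the symbol is a homomorphism: use the bundled `normResidueHom`
  have hhom : hA.normResidueSymbol (k • a + Multiplicative.toAdd (ιhat n)) =
      hA.normResidueSymbol a ^ k * hA.normResidueSymbol (Multiplicative.toAdd (ιhat n)) := by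
    have h := map_add hA.normResidueHom (k • a) (Multiplicative.toAdd (ιhat n))
    rw [map_zsmul] at h
    simp only [IsClassModule.normResidueHom_apply] at h
    exact congrArg Additive.toMul h
  rw [hsplit, hhom, hn1, mul_one, ha_symbol, map_mul, hψn, mul_one, map_zpow, map_zpow]

/-- **… in particular for THE Artin map of the tree's reciprocity law**
(`exists_artinMap_of_isAbelianGalois`: `ψ` onto, kernel `Fˣ N_{E/F} 𝕀_E`, a uniformiser at an
unramified `v` goes to `Frob_v` and local units to `1`): a cyclic layer of the global class formation
has a fundamental class whose norm residue symbol maps the class of a uniformiser at every unramified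
prime `v` to the Frobenius `Frob_v` — the normalisation of Tate's class formation
(Cassels–Fröhlich VII §11.3: the norm residue map of the class formation is the Artin map).
[cite: CasselsFrohlichANT1967, Ch. VII §11.3][cite: CasselsFrohlichANT1967, Ch. VII §5.1 Main Theorem (B)] -/
theorem exists_isClassModule_normResidueSymbol_frobenius [IsGalois F E] [IsCyclic (E ≃ₐ[F] E)] :
    ∃ (ψ : ideleGroup F →* (E ≃ₐ[F] E)) (φ : cocycles₂ (galoisRep F E))
      (hA : IsClassModule (galoisRep F E) φ),
      Function.Surjective ψ ∧ ψ.ker = normGroup F E ∧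
      (∀ v : IsDedekindDomain.HeightOneSpectrum (NumberField.RingOfIntegers F),
        Algebra.IsUnramifiedIn (NumberField.RingOfIntegers E) v.asIdeal →
          ψ (localUnits v (HeckeCharacter.uniformizer F v)) = galFrob F E v ∧
          ∀ u : (v.adicCompletionIntegers F)ˣ,
            ψ (localUnits v (Units.map ((v.adicCompletionIntegers F).subtype : _ →* _) u)) = 1) ∧
      ∀ x : ideleGroup F,
        hA.normResidueSymbol ⟨_, ofMul_classBaseChange_mem_invariants (E := E) x⟩ =
          Abelianization.of (ψ x) := by
  haveI : IsAbelianGalois F E := IsAbelianGalois.of_isCyclic F E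
  obtain ⟨ψ, hsurj, -, hker, hfrob⟩ := exists_artinMap_of_isAbelianGalois F E
  obtain ⟨φ, hA, hsymb⟩ := exists_isClassModule_normResidueSymbol_eq ψ hsurj hker
  exact ⟨ψ, φ, hA, hsurj, hker, hfrob, hsymb⟩

end IdeleClassGroup

end Literature.NumberTheory.Automorphic

end
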